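import Summits.ResolutionOfSingularities.ResolutionOfSingularities.Theses.FrobeniusClosing
import Summits.ResolutionOfSingularities.ResolutionOfSingularities.Theses.ShadowGame
import Summits.ResolutionOfSingularities.ResolutionOfSingularities.Theses.WildCones
import Summits.ResolutionOfSingularities.ResolutionOfSingularities.Theses.FoliationDescent
import Summits.ResolutionOfSingularities.ResolutionOfSingularities.Theses.JacobianBudget
import Summits.ResolutionOfSingularities.ResolutionOfSingularities.Theorems.DefectlessFramesDefectlessFramesRefutation
import Summits.ResolutionOfSingularities.ResolutionOfSingularities.Theorems.ValuativeTorsorToLurelFfiniteTransport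
import Literature.AlgebraicGeometry.Resolution.ResolutionLU
import Literature.AlgebraicGeometry.Resolution.AffineModelObstructions
import Literature.AlgebraicGeometry.Resolution.LocalUniformizationEssFiniteType
import Literature.AlgebraicGeometry.Resolution.LocalUniformizationClosedPoints
import Literature.AlgebraicGeometry.Resolution.LocalUniformizationAbhyankarPlaces
import Literature.AlgebraicGeometry.Resolution.ArithmeticalThreefoldsLocalInseparable
import Mathlib.RingTheory.Jacobson.Ring

/-!
# Disproof of `TorsorToLurelPerfect` (stmt-ResolutionOfSingularities-16162) — standing disprover's work file

Crux (shared ×5: routes ShadowGame = primary decl / FrobeniusClosing = payload route / WildCones /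
FoliationDescent / JacobianBudget; the five constants are the same term, §0):
`TorsorToLurelPerfect := ∀ p prime, H p → C p` with
* `H p = PerfectTorsorLU p` — local uniformization of `α_p`-torsors `t ^ p = a` over bases
  regular at the centre, over PERFECT ground fields of characteristic `p` (= body of the route
  item `TorsorLUPerfect` at `p`);
* `C p = PerfectLUrel p` — relative local uniformization over PERFECT ground fields of
  characteristic `p`.

## Findings (cycle 1, 2026-08-17, refuter-cdisprove-…-16162-0) — NO KILL; everything in this file is `lean check` rc 0, 0 sorries

LANDED (all ACCEPTED, `--supports stmt-…-16162`, std axioms), under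
`Theorems/TorsorToLurelPerfect/Negative/`: `HypothesisNecessary.lean` (p153715: `torsorLU_of_lurel_perfect`
= `C → H`, `torsorToLurelPerfect_iff_forall_iff`, `not_torsorToLurelPerfect_iff`,
`exists_not_resolutionInChar_of_not_torsorToLurelPerfect`), `ConclusionLoadBearing.lean` (p154367:
`not_lurelPerfect_without_kfg/_rfg/_rle`, `lurelPerfect_without_reg`), `HypothesisLoadBearing.lean`
(p154201: `not_torsorLUPerfect_without_frac/_tp`, `lurelPerfect_of_torsorLU_without_baseReg`,
`simple_step`, `simple_steps`, `lurelPerfect_of_simpleLU`). Ideators / planners / the lead may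
IMPORT those modules; this work file restates them with the local names below.

* §1 WHY IT RESISTS (all proved): `perfectTorsorLU_of_perfectLUrel : C p → H p` (the hypothesis
  is NECESSARY — the crux is prime by prime the EQUIVALENCE `H p ↔ C p`, `crux_iff_forall_iff`),
  `perfectLUrel_of_resolutionInChar : Res p → C p` (tree `lurel_of_resolutionInChar`),
  `crux_of_summit`, `not_crux_iff : ¬crux ↔ ∃ p prime, H p ∧ ¬ C p`,
  `not_resolutionInChar_of_not_crux`. An unconditional `¬crux` exhibits a prime `p` at which
  torsor LU holds over every perfect field while LU fails for some `K/k`, `k` perfect — a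
  counterexample to resolution in characteristic `p` (open only in `trdeg ≥ 4`). No finite /
  degenerate / junk-model refutation exists: the junk models are all FREE for `C` (§2:
  `O = K`, valuation rings essentially of finite type, Abhyankar places) and `C → H` transfers
  that freeness to `H`.
* §2 LOAD-BEARING ANALYSIS OF THE CONCLUSION `C p` (theorems): `k ⊆ O` REDUNDANT
  (`perfectLUrelNoConst_iff`); `IsFractionRing A K` REDUNDANT (`perfectLUrelNoFrac_iff`);
  regularity at the centre is THE ENTIRE CONTENT (`perfectLUrelNoReg_holds`, hence the crux with
  that conjunct dropped is provable WITHOUT its hypothesis, `cruxNoRegC_holds`); `K/k` finitely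
  generated LOAD-BEARING (`not_perfectLUrelNoKFG`, every prime; then the mutated crux is
  `∀ p, ¬ H p`, `cruxNoKFG_iff`, and REFUTES resolution in every characteristic,
  `not_resolutionInChar_of_cruxNoKFG` — a trap, not a theorem); `R.FG` LOAD-BEARING
  (`not_perfectLUrelNoRFG`, every prime, Zariski's lemma at the trivial valuation); `R ⊆ O`
  LOAD-BEARING (`not_perfectLUrelNoRO`, `𝔽₂(X)` `X`-adic); `C` is FREE at `O = K`
  (`perfectLUrel_at_top`) and reduces to its HARD CORE — zero-dimensional NON-Abhyankar places
  (`perfectLUrelHard_iff`, Knaf–Kuhlmann + closed points of `Zar(K/R)` + Serre descent, all tree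
  theorems); `p.Prime` NOT load-bearing (`cruxAllNat_iff`; `H 0` is false, `not_perfectTorsorLU_zero`).
  `[PerfectField k]` dropped from `C` gives `LUrel p` (all ground fields): a STRONGER
  crux (`cruxAllFields_imp_crux`), not refutable here (it is `Valuative.TorsorToLurel`'s business
  modulo `LUrelPerfect → LUrel`, which is Temkin's theorem again).
* §3 LOAD-BEARING ANALYSIS OF THE HYPOTHESIS `H p` (theorems): regularity of the BASE `A₀`
  dropped ⇒ `H` becomes `C` itself (`perfectTorsorLUNoReg_iff`: the crux with that hypothesis is
  `C ↔ C`, provable outright, `cruxNoRegH_holds`) — the base's regularity is exactly what makes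
  `H` weaker than `C`; `IsFractionRing (A₀[t]) K` dropped ⇒ `H` FALSE (`not_perfectTorsorLUNoFrac`,
  `𝔽_p^alg`, every prime) ⇒ mutated crux vacuously true (trap); `t ^ p ∈ A₀` dropped ⇒ `H` FALSE
  for the silly reason `t ∉ O` (`not_perfectTorsorLUNoTp`, `t = X` at the place at infinity of
  `𝔽_p(X)`, every prime) ⇒ trap; the INFORMATIVE mutation replaces `t ^ p ∈ A₀` by `t ∈ O`
  (arbitrary simple extensions inside `O`): that hypothesis is EQUIVALENT to `C`
  (`perfectSimpleLU_iff_perfectLUrel`, generator induction through intermediate fields), so the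
  crux so mutated is a TRIVIALITY (`cruxSimple_holds`) — ALL content of `TorsorToLurelPerfect` is
  the restriction to RADICAL simple extensions `t ^ p ∈ A₀`, i.e. exactly what Temkin 2013
  Thm. 1.3.2 + Frobenius over a perfect field buys. `A₀.FG` dropped: `H` false at a DVR `A₀ = O`
  not essentially… (not formalized: needs `IsRegularLocalRing` of a non-finitely-generated DVR;
  argument = `ZariskiCMEngine/Negative/TargetLoadBearing.not_…_without_rfg`).
* §4 TARGETS (pre-analysis of the registered line `temkin-leaf`, stubs not yet handed to this
  seat): `stub_perfectTowerClimb` is WEAKER than the crux (`stub3_of_crux`) and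
  `stub_perfectChartOfTemkin`'s conclusion `PushedChart` follows from `C p` with `m = 0`
  (`pushedChart_of_perfectLUrel`), hence both are summit-implied and admit no refutation short
  of `¬ResolutionInChar p`; the ONLY node of the line that is not summit-implied is the Literature
  leaf `Temkin2013RelativeCurveSmoothFibre` (Temkin 2013 Thm. 3.3.1, smooth generic fibre) — a
  misstatement there is the one conceivable disproof in this cone (audit target, not done here;
  status 2026-08-17 per `RelativeCurveSmoothFibreFromJ2.lean` / `…DiscInputs.lean`: the leaf is
  reduced in tree to the algebraization (J2) of Thm. 3.3.1 Steps 2–4, (J1)/(HR) being PROVED,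
  and the `Temkin2013` Literature unit found the naive `l = k` form of (J2) too strong and
  re-threaded it with disc data — i.e. the leaf's remaining content is being closed, not doubted).
* §5 (docblock at the end): regimes tried, why each fails to bite, what WOULD kill.
-/

set_option linter.dupNamespace false

open scoped Polynomial
open IsLocalRing
open Literature.AlgebraicGeometry.Resolution

namespace Summit.ResolutionOfSingularities.ResolutionOfSingularities.Cruxes.TorsorToLurelPerfect.Disproof

open Summit.ResolutionOfSingularities.ResolutionOfSingularities

noncomputable section

/-! ## §0 The crux, unfolded -/

/-- `H p`: the crux hypothesis at the prime `p` — local uniformization of `α_p`-torsors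
`t ^ p = a` over bases regular at the centre, over PERFECT ground fields (verbatim the
antecedent; = body of route item `TorsorLUPerfect` at `p`). -/
def PerfectTorsorLU (p : ℕ) : Prop :=
  ∀ (k K : Type) [Field k] [CharP k p] [PerfectField k] [Field K] [Algebra k K]
    (O : ValuationSubring K) (A₀ : Subalgebra k K) (h₀ : A₀.toSubring ≤ O.toSubring) (t : K),
    A₀.FG → t ^ p ∈ A₀ → IsFractionRing (Algebra.adjoin k (insert t (A₀ : Set K))) K →
    IsRegularLocalRing (Localization.AtPrime
      (Ideal.comap (Subring.inclusion h₀) (maximalIdeal O))) →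
    ∃ (A : Subalgebra k K) (h : A.toSubring ≤ O.toSubring), A₀ ≤ A ∧ t ∈ A ∧ A.FG ∧
      IsFractionRing A K ∧
      IsRegularLocalRing (Localization.AtPrime (Ideal.comap (Subring.inclusion h) (maximalIdeal O)))

/-- `C p`: the crux conclusion at the prime `p` — relative local uniformization over PERFECT
ground fields of characteristic `p` (verbatim the consequent). -/
def PerfectLUrel (p : ℕ) : Prop :=
  ∀ (k K : Type) [Field k] [CharP k p] [PerfectField k] [Field K] [Algebra k K],
    (⊤ : IntermediateField k K).FG → ∀ O : ValuationSubring K, (∀ c : k, algebraMap k K c ∈ O) →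
    ∀ R : Subalgebra k K, R.FG → R.toSubring ≤ O.toSubring →
    ∃ (A : Subalgebra k K) (h : A.toSubring ≤ O.toSubring), R ≤ A ∧ A.FG ∧ IsFractionRing A K ∧
      IsRegularLocalRing (Localization.AtPrime (Ideal.comap (Subring.inclusion h) (maximalIdeal O)))

/-- The crux (payload route FrobeniusClosing) is `∀ p prime, H p → C p` (definitional). -/
theorem crux_iff :
    Theses.FrobeniusClosing.TorsorToLurelPerfect ↔
      ∀ p : ℕ, p.Prime → PerfectTorsorLU p → PerfectLUrel p :=
  Iff.rfl

/-- The five route copies of the crux are one term (primary decl: ShadowGame). -/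
theorem shadowGame_iff :
    Theses.ShadowGame.TorsorToLurelPerfect ↔ Theses.FrobeniusClosing.TorsorToLurelPerfect := Iff.rfl

theorem wildCones_iff :
    Theses.WildCones.TorsorToLurelPerfect ↔ Theses.FrobeniusClosing.TorsorToLurelPerfect := Iff.rfl

theorem foliationDescent_iff :
    Theses.FoliationDescent.TorsorToLurelPerfect ↔ Theses.FrobeniusClosing.TorsorToLurelPerfect :=
  Iff.rfl

theorem jacobianBudget_iff :
    Theses.JacobianBudget.TorsorToLurelPerfect ↔ Theses.FrobeniusClosing.TorsorToLurelPerfect :=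
  Iff.rfl

/-- The route item `TorsorLUPerfect` (support, stmt-16158) is `∀ p prime, H p` (definitional). -/
theorem torsorLUPerfect_iff :
    Theses.FrobeniusClosing.TorsorLUPerfect ↔ ∀ p : ℕ, p.Prime → PerfectTorsorLU p := Iff.rfl

/-! ## §1 Logical position: why the crux resists refutation -/

/-- `t ^ n ∈ O`, `n ≠ 0` ⇒ `t ∈ O` (valuation rings are integrally closed; elementary form).
[folklore] -/
theorem mem_of_pow_mem_valuationSubring {K : Type*} [Field K] (O : ValuationSubring K) {t : K}
    {n : ℕ} (hn : n ≠ 0) (ht : t ^ n ∈ O) : t ∈ O := by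
  rcases O.mem_or_inv_mem t with h | h
  · exact h
  · by_cases ht0 : t = 0
    · rw [ht0]; exact O.zero_mem
    · have key : t = t ^ n * (t⁻¹) ^ (n - 1) := by
        rw [inv_pow, ← pow_sub₀ t ht0 (Nat.sub_le n 1),
          Nat.sub_sub_self (Nat.one_le_iff_ne_zero.mpr hn), pow_one]
      rw [key]
      exact mul_mem ht (pow_mem h _)

/-- `Res p → C p` (tree `lurel_of_resolutionInChar`, restricted to perfect ground fields).
[folklore] -/
theorem perfectLUrel_of_resolutionInChar {p : ℕ} (hp : p.Prime) (h : ResolutionInChar.{0} p) :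
    PerfectLUrel p :=
  fun k K _ _ _ _ _ hKfg O hO R hRfg hRO => lurel_of_resolutionInChar p hp h k K hKfg O hO R hRfg hRO

/-- **`C p → H p`: the crux hypothesis is NECESSARY** — torsor LU is the instance
`R := k[A₀, t]` of relative LU (`t ∈ O` because `t ^ p ∈ A₀ ⊆ O`; `K/k` is finitely generated
because `K = Frac k[A₀, t]`). The regularity of the base `A₀` is NOT used. So the crux is,
prime by prime, the equivalence `H p ↔ C p`. [folklore] -/
theorem perfectTorsorLU_of_perfectLUrel {p : ℕ} (hp : p.Prime) (hC : PerfectLUrel p) :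
    PerfectTorsorLU p := by
  intro k K _ _ _ _ _ O A₀ h₀ t hfg htp hfrac _hreg
  classical
  obtain ⟨s₀, hs₀⟩ := hfg
  have hO : ∀ c : k, algebraMap k K c ∈ O := fun c => h₀ (A₀.algebraMap_mem c)
  have htO : t ∈ O := mem_of_pow_mem_valuationSubring O hp.ne_zero (h₀ htp)
  have hRs : Algebra.adjoin k (insert t (A₀ : Set K)) = Algebra.adjoin k (insert t (s₀ : Set K)) := by
    rw [← hs₀, Algebra.adjoin_insert_adjoin]
  have hRfg : (Algebra.adjoin k (insert t (A₀ : Set K))).FG :=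
    ⟨insert t s₀, by rw [Finset.coe_insert, hRs]⟩
  have hKfg : (⊤ : IntermediateField k K).FG := by
    refine ⟨insert t s₀, top_le_iff.mp fun z _ => ?_⟩
    obtain ⟨a, b, -, rfl⟩ :=
      IsFractionRing.div_surjective (A := Algebra.adjoin k (insert t (A₀ : Set K))) z
    have hle : Algebra.adjoin k (insert t (A₀ : Set K)) ≤
        (IntermediateField.adjoin k ((insert t s₀ : Finset K) : Set K)).toSubalgebra := by
      rw [hRs, Finset.coe_insert]
      exact IntermediateField.algebra_adjoin_le_adjoin k _
    exact div_mem (hle a.2) (hle b.2)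
  let Oalg : Subalgebra k K := { O.toSubring with algebraMap_mem' := hO }
  have hRO : (Algebra.adjoin k (insert t (A₀ : Set K))).toSubring ≤ O.toSubring := by
    change Algebra.adjoin k (insert t (A₀ : Set K)) ≤ Oalg
    exact Algebra.adjoin_le (Set.insert_subset htO fun x hx => h₀ hx)
  obtain ⟨A, h, hRA, hAfg, hAfr, hAreg⟩ := hC k K hKfg O hO _ hRfg hRO
  exact ⟨A, h, fun x hx => hRA (Algebra.subset_adjoin (Set.mem_insert_of_mem t hx)),
    hRA (Algebra.subset_adjoin (Set.mem_insert t _)), hAfg, hAfr, hAreg⟩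

/-- Hence the crux is, prime by prime, the EQUIVALENCE of torsor LU and relative LU over
perfect ground fields. [folklore] -/
theorem crux_iff_forall_iff :
    Theses.FrobeniusClosing.TorsorToLurelPerfect ↔
      ∀ p : ℕ, p.Prime → (PerfectTorsorLU p ↔ PerfectLUrel p) :=
  ⟨fun h p hp => ⟨h p hp, perfectTorsorLU_of_perfectLUrel hp⟩, fun h p hp => (h p hp).mp⟩

/-- `(∀ p prime, C p) → crux` (ignore the hypothesis). [folklore] -/
theorem crux_of_perfectLUrel (h : ∀ p : ℕ, p.Prime → PerfectLUrel p) :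
    Theses.FrobeniusClosing.TorsorToLurelPerfect :=
  fun p hp _ => h p hp

/-- **The crux follows from the summit** (it is not stronger than the problem). [folklore] -/
theorem crux_of_summit (h : _root_.ResolutionOfSingularities) :
    Theses.FrobeniusClosing.TorsorToLurelPerfect :=
  crux_of_perfectLUrel fun _ hp => perfectLUrel_of_resolutionInChar hp (h _ hp)

/-- **Why it resists**: a refutation of the crux is exactly a prime `p` at which torsor LU over
perfect fields HOLDS and relative LU over some perfect field FAILS. [folklore] -/
theorem not_crux_iff :
    ¬ Theses.FrobeniusClosing.TorsorToLurelPerfect ↔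
      ∃ p : ℕ, p.Prime ∧ PerfectTorsorLU p ∧ ¬ PerfectLUrel p := by
  constructor
  · intro h
    by_contra h'
    exact h fun p hp hH => by_contra fun hC => h' ⟨p, hp, hH, hC⟩
  · rintro ⟨p, hp, hH, hC⟩ h
    exact hC (h p hp hH)

/-- … in particular an unconditional `¬crux` is a counterexample to resolution in some prime
characteristic. [folklore] -/
theorem not_resolutionInChar_of_not_crux (h : ¬ Theses.FrobeniusClosing.TorsorToLurelPerfect) :
    ∃ p : ℕ, p.Prime ∧ ¬ ResolutionInChar.{0} p := by
  obtain ⟨p, hp, -, hC⟩ := not_crux_iff.mp h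
  exact ⟨p, hp, fun hR => hC (perfectLUrel_of_resolutionInChar hp hR)⟩

theorem not_summit_of_not_crux (h : ¬ Theses.FrobeniusClosing.TorsorToLurelPerfect) :
    ¬ _root_.ResolutionOfSingularities :=
  fun hS => h (crux_of_summit hS)

/-! ## §2 Load-bearing analysis of the CONCLUSION `C p` -/

/-- (C1) `C p` with the hypothesis `k ⊆ O` dropped. -/
def PerfectLUrelNoConst (p : ℕ) : Prop :=
  ∀ (k K : Type) [Field k] [CharP k p] [PerfectField k] [Field K] [Algebra k K],
    (⊤ : IntermediateField k K).FG → ∀ O : ValuationSubring K,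
    ∀ R : Subalgebra k K, R.FG → R.toSubring ≤ O.toSubring →
    ∃ (A : Subalgebra k K) (h : A.toSubring ≤ O.toSubring), R ≤ A ∧ A.FG ∧ IsFractionRing A K ∧
      IsRegularLocalRing (Localization.AtPrime (Ideal.comap (Subring.inclusion h) (maximalIdeal O)))

/-- (C1) **`k ⊆ O` is REDUNDANT** (it follows from `R ⊆ O`, `R` being a `k`-subalgebra): users of
`C p` need not supply it. [folklore] -/
theorem perfectLUrelNoConst_iff (p : ℕ) : PerfectLUrelNoConst p ↔ PerfectLUrel p :=
  ⟨fun h k K _ _ _ _ _ hfg O _ R hR hRO => h k K hfg O R hR hRO,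
    fun h k K _ _ _ _ _ hfg O R hR hRO => h k K hfg O (fun c => hRO (R.algebraMap_mem c)) R hR hRO⟩

/-- (C2) `C p` with finite generation of `K/k` dropped. -/
def PerfectLUrelNoKFG (p : ℕ) : Prop :=
  ∀ (k K : Type) [Field k] [CharP k p] [PerfectField k] [Field K] [Algebra k K],
    ∀ O : ValuationSubring K, (∀ c : k, algebraMap k K c ∈ O) →
    ∀ R : Subalgebra k K, R.FG → R.toSubring ≤ O.toSubring →
    ∃ (A : Subalgebra k K) (h : A.toSubring ≤ O.toSubring), R ≤ A ∧ A.FG ∧ IsFractionRing A K ∧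
      IsRegularLocalRing (Localization.AtPrime (Ideal.comap (Subring.inclusion h) (maximalIdeal O)))

/-- (C2) **Without finite generation of `K/k` the conclusion is FALSE in every prime
characteristic** (`k = 𝔽_p` is perfect, `K = 𝔽_p^alg` has no affine model; tree
`not_exists_fg_isFractionRing_algebraicClosure`). [folklore] -/
theorem not_perfectLUrelNoKFG {p : ℕ} (hp : p.Prime) : ¬ PerfectLUrelNoKFG p := by
  intro h
  haveI : Fact p.Prime := ⟨hp⟩
  obtain ⟨A, -, -, hfg, hfr, -⟩ := h (ZMod p) (AlgebraicClosure (ZMod p)) ⊤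
    (fun c => ValuationSubring.mem_top _) ⊥ Subalgebra.fg_bot (fun _ _ => ValuationSubring.mem_top _)
  exact not_exists_fg_isFractionRing_algebraicClosure p ⟨A, hfg, hfr⟩

/-- (C2) … so the crux with that conclusion is, prime by prime, the NEGATION of its own
hypothesis … -/
theorem cruxNoKFG_iff :
    (∀ p : ℕ, p.Prime → PerfectTorsorLU p → PerfectLUrelNoKFG p) ↔
      ∀ p : ℕ, p.Prime → ¬ PerfectTorsorLU p :=
  ⟨fun h p hp hH => not_perfectLUrelNoKFG hp (h p hp hH), fun h p hp hH => absurd hH (h p hp)⟩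

/-- (C2) … and REFUTES resolution in every prime characteristic (`Res p → C p → H p`): a trap,
not a theorem. -/
theorem not_resolutionInChar_of_cruxNoKFG
    (h : ∀ p : ℕ, p.Prime → PerfectTorsorLU p → PerfectLUrelNoKFG p) (p : ℕ) (hp : p.Prime) :
    ¬ ResolutionInChar.{0} p :=
  fun hR => cruxNoKFG_iff.mp h p hp
    (perfectTorsorLU_of_perfectLUrel hp (perfectLUrel_of_resolutionInChar hp hR))

/-- (C3) `C p` with finite generation of the PRESCRIBED algebra `R` dropped. -/
def PerfectLUrelNoRFG (p : ℕ) : Prop :=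
  ∀ (k K : Type) [Field k] [CharP k p] [PerfectField k] [Field K] [Algebra k K],
    (⊤ : IntermediateField k K).FG → ∀ O : ValuationSubring K, (∀ c : k, algebraMap k K c ∈ O) →
    ∀ R : Subalgebra k K, R.toSubring ≤ O.toSubring →
    ∃ (A : Subalgebra k K) (h : A.toSubring ≤ O.toSubring), R ≤ A ∧ A.FG ∧ IsFractionRing A K ∧
      IsRegularLocalRing (Localization.AtPrime (Ideal.comap (Subring.inclusion h) (maximalIdeal O)))

/-- (C3) **`R.FG` is LOAD-BEARING**: without it the conclusion is false in every prime
characteristic — at the trivial valuation `O = K` of `K = 𝔽_p(X)` take `R = K`; a finitely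
generated `A ⊇ K` makes `K` a finitely generated `𝔽_p`-algebra, hence finite over `𝔽_p`
(Zariski's lemma), contradicting the transcendence of `X` (argument of the sibling
`PatchingRel/Disproof.not_lurelNoRFG`, perfect ground field `𝔽_p`). [folklore] -/
theorem not_perfectLUrelNoRFG {p : ℕ} (hp : p.Prime) : ¬ PerfectLUrelNoRFG p := by
  intro h
  haveI : Fact p.Prime := ⟨hp⟩
  obtain ⟨A, -, hle, hAfg, -, -⟩ := h (ZMod p) (FractionRing (Polynomial (ZMod p)))
    (IntermediateField.fg_top_iff.mpr
      (Algebra.EssFiniteType.comp (ZMod p) (Polynomial (ZMod p)) _))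
    ⊤ (fun _ => ValuationSubring.mem_top _) ⊤ (fun _ _ => ValuationSubring.mem_top _)
  have htop : (⊤ : Subalgebra (ZMod p) (FractionRing (Polynomial (ZMod p)))).FG := by
    rwa [← eq_top_iff.mpr hle]
  haveI : Algebra.FiniteType (ZMod p) (FractionRing (Polynomial (ZMod p))) := ⟨htop⟩
  haveI : Module.Finite (ZMod p) (FractionRing (Polynomial (ZMod p))) :=
    finite_of_finite_type_of_isJacobsonRing (ZMod p) _
  have hT : Transcendental (ZMod p)
      (algebraMap (Polynomial (ZMod p)) (FractionRing (Polynomial (ZMod p))) Polynomial.X) :=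
    (transcendental_algebraMap_iff (IsFractionRing.injective (Polynomial (ZMod p)) _)).mpr
      (Polynomial.transcendental_X (ZMod p))
  exact hT (Algebra.IsAlgebraic.isAlgebraic _)

/-- (C3) … so the crux with that conclusion is again `∀ p, ¬ H p` (a second trap). -/
theorem cruxNoRFG_iff :
    (∀ p : ℕ, p.Prime → PerfectTorsorLU p → PerfectLUrelNoRFG p) ↔
      ∀ p : ℕ, p.Prime → ¬ PerfectTorsorLU p :=
  ⟨fun h p hp hH => not_perfectLUrelNoRFG hp (h p hp hH), fun h p hp hH => absurd hH (h p hp)⟩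

/-- (C4) `C p` with the hypothesis `R ⊆ O` dropped. -/
def PerfectLUrelNoRO (p : ℕ) : Prop :=
  ∀ (k K : Type) [Field k] [CharP k p] [PerfectField k] [Field K] [Algebra k K],
    (⊤ : IntermediateField k K).FG → ∀ O : ValuationSubring K, (∀ c : k, algebraMap k K c ∈ O) →
    ∀ R : Subalgebra k K, R.FG →
    ∃ (A : Subalgebra k K) (h : A.toSubring ≤ O.toSubring), R ≤ A ∧ A.FG ∧ IsFractionRing A K ∧
      IsRegularLocalRing (Localization.AtPrime (Ideal.comap (Subring.inclusion h) (maximalIdeal O)))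

section witnessOX
open Theorems.DefectlessFramesRefutation
open IsDedekindDomain.HeightOneSpectrum

/-- Constants lie in the `X`-adic valuation ring `OX` of `𝔽₂(X)` (tree witness). [folklore] -/
theorem const_mem_OX : ∀ c : kW, algebraMap kW KW c ∈ OX := by
  intro c
  rw [Valuation.mem_valuationSubring_iff, IsScalarTower.algebraMap_apply kW kW[X] KW]
  exact valuation_le_one _ _

/-- `𝔽₂(X)` is finitely generated over `𝔽₂`. [folklore] -/
theorem fg_top_KW : (⊤ : IntermediateField kW KW).FG := ⟨{RatFunc.X}, by simp [RatFunc.adjoin_X]⟩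

/-- (C4) **`R ⊆ O` is LOAD-BEARING** (trivially): at `p = 2`, `K = 𝔽₂(X)` with the `X`-adic
valuation ring `O` (tree `OX`), the finitely generated `R = 𝔽₂[X⁻¹]` sits below no `A ⊆ O`.
[folklore] -/
theorem not_perfectLUrelNoRO_two : ¬ PerfectLUrelNoRO 2 := by
  intro H
  obtain ⟨A, hA, hle, -, -, -⟩ :=
    H kW KW fg_top_KW OX const_mem_OX (Algebra.adjoin kW {(RatFunc.X : KW)⁻¹})
      (Subalgebra.fg_def.mpr ⟨{(RatFunc.X : KW)⁻¹}, Set.finite_singleton _, rfl⟩)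
  have h1 : (RatFunc.X : KW)⁻¹ ∈ A := hle (Algebra.subset_adjoin (Set.mem_singleton _))
  have hinv : (RatFunc.X : KW)⁻¹ ∉ OX := by
    rw [Valuation.mem_valuationSubring_iff, map_inv₀]
    change ¬ (vX RatFunc.X)⁻¹ ≤ 1
    rw [Polynomial.valuation_X_eq_neg_one, ← WithZero.exp_neg, ← WithZero.exp_zero,
      WithZero.exp_le_exp]
    decide
  exact hinv (hA (A.mem_toSubring.mpr h1))

theorem not_perfectLUrelNoRO : ¬ ∀ p : ℕ, p.Prime → PerfectLUrelNoRO p :=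
  fun h => not_perfectLUrelNoRO_two (h 2 Nat.prime_two)

end witnessOX

/-- (C5) `C p` with `IsFractionRing A K` dropped from its conclusion. -/
def PerfectLUrelNoFrac (p : ℕ) : Prop :=
  ∀ (k K : Type) [Field k] [CharP k p] [PerfectField k] [Field K] [Algebra k K],
    (⊤ : IntermediateField k K).FG → ∀ O : ValuationSubring K, (∀ c : k, algebraMap k K c ∈ O) →
    ∀ R : Subalgebra k K, R.FG → R.toSubring ≤ O.toSubring →
    ∃ (A : Subalgebra k K) (h : A.toSubring ≤ O.toSubring), R ≤ A ∧ A.FG ∧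
      IsRegularLocalRing (Localization.AtPrime (Ideal.comap (Subring.inclusion h) (maximalIdeal O)))

/-- (C5) **`IsFractionRing A K` is REDUNDANT** in the conclusion: enlarge `R` by an affine model
of `K` inside `O` (`exists_affineModel`) before uniformizing. Provers may ignore that conjunct
when USING `C p` and need not establish it when PROVING it. [folklore] -/
theorem perfectLUrelNoFrac_iff (p : ℕ) : PerfectLUrelNoFrac p ↔ PerfectLUrel p := by
  refine ⟨fun h k K _ _ _ _ _ hKfg O hO R hRfg hRO => ?_,
    fun h k K _ _ _ _ _ hKfg O hO R hRfg hRO => ?_⟩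
  · obtain ⟨A₀, hA₀O, hA₀fg, hA₀fr⟩ := exists_affineModel k K hKfg O hO
    have hR'O : (R ⊔ A₀).toSubring ≤ O.toSubring := by
      let Oalg : Subalgebra k K := { O.toSubring with algebraMap_mem' := hO }
      change R ⊔ A₀ ≤ Oalg
      exact sup_le (fun x hx => hRO hx) (fun x hx => hA₀O hx)
    have hR'fr : IsFractionRing ↥(R ⊔ A₀) K := isFractionRing_of_le le_sup_right hA₀fr
    obtain ⟨A, hA, hle, hAfg, hreg⟩ := h k K hKfg O hO (R ⊔ A₀) (hRfg.sup hA₀fg) hR'O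
    exact ⟨A, hA, le_sup_left.trans hle, hAfg, isFractionRing_of_le hle hR'fr, hreg⟩
  · obtain ⟨A, hA, hle, hAfg, -, hreg⟩ := h k K hKfg O hO R hRfg hRO
    exact ⟨A, hA, hle, hAfg, hreg⟩

/-- (C6) `C p` with REGULARITY AT THE CENTRE dropped from its conclusion. -/
def PerfectLUrelNoReg (p : ℕ) : Prop :=
  ∀ (k K : Type) [Field k] [CharP k p] [PerfectField k] [Field K] [Algebra k K],
    (⊤ : IntermediateField k K).FG → ∀ O : ValuationSubring K, (∀ c : k, algebraMap k K c ∈ O) →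
    ∀ R : Subalgebra k K, R.FG → R.toSubring ≤ O.toSubring →
    ∃ (A : Subalgebra k K) (_ : A.toSubring ≤ O.toSubring), R ≤ A ∧ A.FG ∧ IsFractionRing A K

/-- (C6) Without regularity the conclusion is a TRIVIALITY (`A = R ⊔ A₀`, `A₀` an affine model
of `K` inside `O`) … [folklore] -/
theorem perfectLUrelNoReg_holds (p : ℕ) : PerfectLUrelNoReg p := by
  intro k K _ _ _ _ _ hKfg O hO R hRfg hRO
  obtain ⟨A₀, hA₀O, hA₀fg, hA₀fr⟩ := exists_affineModel k K hKfg O hO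
  have hR'O : (R ⊔ A₀).toSubring ≤ O.toSubring := by
    let Oalg : Subalgebra k K := { O.toSubring with algebraMap_mem' := hO }
    change R ⊔ A₀ ≤ Oalg
    exact sup_le (fun x hx => hRO hx) (fun x hx => hA₀O hx)
  exact ⟨R ⊔ A₀, hR'O, le_sup_left, hRfg.sup hA₀fg, isFractionRing_of_le le_sup_right hA₀fr⟩

/-- (C6) … so the crux with that conjunct dropped is provable WITHOUT its hypothesis: regularity
at the centre is the entire content of `C p`. [folklore] -/
theorem cruxNoRegC_holds : ∀ p : ℕ, p.Prime → PerfectTorsorLU p → PerfectLUrelNoReg p :=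
  fun p _ _ => perfectLUrelNoReg_holds p

/-- (C7) **`C p` is FREE at the trivial valuation `O = K`** (the junk model every refuter tries
first; more generally at every valuation ring essentially of finite type over `k`, tree
`lurel_of_essFiniteType`): all conjuncts hold there, uniformly in `p` and the dimension.
[folklore] -/
theorem perfectLUrel_at_top {k K : Type} [Field k] [Field K] [Algebra k K]
    (hKfg : (⊤ : IntermediateField k K).FG) (R : Subalgebra k K) (hRfg : R.FG) :
    ∃ (A : Subalgebra k K) (h : A.toSubring ≤ (⊤ : ValuationSubring K).toSubring), R ≤ A ∧ A.FG ∧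
      IsFractionRing A K ∧ IsRegularLocalRing (Localization.AtPrime
        (Ideal.comap (Subring.inclusion h) (maximalIdeal (⊤ : ValuationSubring K)))) := by
  obtain ⟨A₀, -, hA₀fg, hA₀fr⟩ :=
    exists_affineModel k K hKfg ⊤ (fun c => ValuationSubring.mem_top _)
  have hloc : ∀ x : K, x ∈ (⊤ : ValuationSubring K) → ∃ b ∈ A₀, ∃ s ∈ A₀, s ≠ 0 ∧
      s⁻¹ ∈ (⊤ : ValuationSubring K) ∧ x = b * s⁻¹ := by
    intro x _
    obtain ⟨a, s, hs, rfl⟩ := IsFractionRing.div_surjective (A := A₀) x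
    refine ⟨a, a.2, s, s.2, ?_, ValuationSubring.mem_top _, by rw [div_eq_mul_inv]; rfl⟩
    intro h0
    exact nonZeroDivisors.ne_zero hs (Subtype.ext h0)
  obtain ⟨A, h, hRA, hA₀A, hAfg, hreg⟩ := lurel_of_essFiniteType ⊤ A₀ hA₀fg
    (fun _ _ => ValuationSubring.mem_top _) hloc R hRfg (fun _ _ => ValuationSubring.mem_top _)
  exact ⟨A, h, hRA, hAfg, isFractionRing_of_le hA₀A hA₀fr, hreg⟩

/-- (C8) The HARD CORE of `C p`: LU demanded only at valuation rings that are ZERO-DIMENSIONAL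
(closed points of `Zar(K/k)`: every `x ∈ O` is a root modulo `𝔪_O` of a non-zero polynomial over
`k`) and NOT Abhyankar places (strict Abhyankar inequality). -/
def PerfectLUrelHard (p : ℕ) : Prop :=
  ∀ (k K : Type) [Field k] [CharP k p] [PerfectField k] [Field K] [Algebra k K],
    (⊤ : IntermediateField k K).FG →
    ∀ O : ValuationSubring K, (∀ c : k, algebraMap k K c ∈ O) →
      (∀ x ∈ O, ∃ f : Polynomial k, f ≠ 0 ∧ Polynomial.aeval x f ∈ O.nonunits) →
      ¬ IsAbhyankarPlace O (algebraMap k K).fieldRange ⊤ →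
      ∀ R : Subalgebra k K, R.FG → R.toSubring ≤ O.toSubring →
      ∃ (A : Subalgebra k K) (h : A.toSubring ≤ O.toSubring),
        R ≤ A ∧ A.FG ∧ IsFractionRing A K ∧ IsRegularLocalRing (Localization.AtPrime
          (Ideal.comap (Subring.inclusion h) (maximalIdeal O)))

/-- (C8) **`C p` is equivalent to its hard core** (`PerfectLUrelHard p ↔ PerfectLUrel p`):
refine `O` to a closed point of `Zar(K/R)` below it (tree `exists_minimal_valuationSubring_le`,
zero-dimensional by `exists_aeval_mem_nonunits_of_minimal`); an Abhyankar place is uniformized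
for free over a perfect ground field (Knaf–Kuhlmann 2005, tree
`relLU_at_abhyankarPlace_of_perfectField`), otherwise by hypothesis; regularity descends to the
coarsening `O` by Serre (tree `isRegularLocalRing_centre_of_le`). So via `C → H` the crux
hypothesis too is being fed exactly Kuhlmann's defect / rank-deficient zero-dimensional
valuations, and a refutation of `C` would have to live precisely there. [folklore] -/
theorem perfectLUrelHard_iff (p : ℕ) : PerfectLUrelHard p ↔ PerfectLUrel p := by
  refine ⟨fun h k K _ _ _ _ _ hKfg O hO R hRfg hRO => ?_,
    fun h k K _ _ _ _ _ hKfg O hO _ _ R hRfg hRO => h k K hKfg O hO R hRfg hRO⟩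
  obtain ⟨O', hO'O, hRO', hmin⟩ := exists_minimal_valuationSubring_le R O hRO
  have hO' : ∀ c : k, algebraMap k K c ∈ O' := fun c => hRO' (R.algebraMap_mem c)
  by_cases hAbh : IsAbhyankarPlace O' (algebraMap k K).fieldRange ⊤
  · obtain ⟨A, hA, hRA, hAfg, hfr, hreg⟩ :=
      relLU_at_abhyankarPlace_of_perfectField hKfg O' hO' hAbh R hRfg hRO'
    exact ⟨A, fun x hx => hO'O (hA hx), hRA, hAfg, hfr,
      isRegularLocalRing_centre_of_le A hO'O hA _ hreg⟩
  · obtain ⟨A, hA, hRA, hAfg, hfr, hreg⟩ := h k K hKfg O' hO'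
      (exists_aeval_mem_nonunits_of_minimal R hRfg O' hRO' hmin) hAbh R hRfg hRO'
    exact ⟨A, fun x hx => hO'O (hA hx), hRA, hAfg, hfr,
      isRegularLocalRing_centre_of_le A hO'O hA _ hreg⟩

/-- (C9) `C p` with `[PerfectField k]` dropped: relative LU over ALL ground fields of
characteristic `p` (`LUrel p`, the antecedent of `Valuative.PatchingRel`). -/
def LUrelAll (p : ℕ) : Prop :=
  ∀ (k K : Type) [Field k] [CharP k p] [Field K] [Algebra k K],
    (⊤ : IntermediateField k K).FG → ∀ O : ValuationSubring K, (∀ c : k, algebraMap k K c ∈ O) →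
    ∀ R : Subalgebra k K, R.FG → R.toSubring ≤ O.toSubring →
    ∃ (A : Subalgebra k K) (h : A.toSubring ≤ O.toSubring), R ≤ A ∧ A.FG ∧ IsFractionRing A K ∧
      IsRegularLocalRing (Localization.AtPrime (Ideal.comap (Subring.inclusion h) (maximalIdeal O)))

/-- (C9) The crux with the all-fields conclusion is a STRONGER statement (it implies the crux);
it is summit-implied as well (`lurel_of_resolutionInChar`), hence not refutable here either. -/
theorem cruxAllFields_imp_crux (h : ∀ p : ℕ, p.Prime → PerfectTorsorLU p → LUrelAll p) :
    Theses.FrobeniusClosing.TorsorToLurelPerfect :=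
  fun p hp hH k K _ _ _ _ _ hKfg O hO R hRfg hRO => h p hp hH k K hKfg O hO R hRfg hRO

theorem cruxAllFields_of_summit (hS : _root_.ResolutionOfSingularities) :
    ∀ p : ℕ, p.Prime → PerfectTorsorLU p → LUrelAll p :=
  fun p hp _ k K _ _ _ _ hKfg O hO R hRfg hRO =>
    lurel_of_resolutionInChar p hp (hS p hp) k K hKfg O hO R hRfg hRO

/-! ## §3 Load-bearing analysis of the HYPOTHESIS `H p` -/

/-- (H2) `H p` with REGULARITY OF THE BASE `A₀` dropped: LU of `k[A₀, t]` for ANY finitely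
generated `A₀ ⊆ O` and `t` with `t ^ p ∈ A₀`, `Frac k[A₀, t] = K`. -/
def PerfectTorsorLUNoReg (p : ℕ) : Prop :=
  ∀ (k K : Type) [Field k] [CharP k p] [PerfectField k] [Field K] [Algebra k K]
    (O : ValuationSubring K) (A₀ : Subalgebra k K) (_ : A₀.toSubring ≤ O.toSubring) (t : K),
    A₀.FG → t ^ p ∈ A₀ → IsFractionRing (Algebra.adjoin k (insert t (A₀ : Set K))) K →
    ∃ (A : Subalgebra k K) (h : A.toSubring ≤ O.toSubring), A₀ ≤ A ∧ t ∈ A ∧ A.FG ∧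
      IsFractionRing A K ∧
      IsRegularLocalRing (Localization.AtPrime (Ideal.comap (Subring.inclusion h) (maximalIdeal O)))

/-- (H2) **Without regularity of the base, `H` IS `C`** (`PerfectTorsorLUNoReg p ↔ PerfectLUrel p`;
`→`: take `A₀ := R ⊔ (affine model)`, `t := 0`; `←`: the proof of `C → H` never used the base's
regularity). So the regularity of `A₀` at the centre is exactly what makes `H` weaker than `C`,
and the crux with this hypothesis is provable outright (`cruxNoRegH_holds`). [folklore] -/
theorem perfectTorsorLUNoReg_iff {p : ℕ} (hp : p.Prime) : PerfectTorsorLUNoReg p ↔ PerfectLUrel p := by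
  refine ⟨fun h k K _ _ _ _ _ hKfg O hO R hRfg hRO => ?_, fun h => ?_⟩
  · obtain ⟨A₁, hA₁O, hA₁fg, hA₁fr⟩ := exists_affineModel k K hKfg O hO
    let Oalg : Subalgebra k K := { O.toSubring with algebraMap_mem' := hO }
    have hR'O : (R ⊔ A₁).toSubring ≤ O.toSubring := by
      change R ⊔ A₁ ≤ Oalg
      exact sup_le (fun x hx => hRO hx) (fun x hx => hA₁O hx)
    have h0 : (0 : K) ^ p ∈ R ⊔ A₁ := by
      rw [zero_pow hp.ne_zero]; exact Subalgebra.zero_mem _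
    have hle : R ⊔ A₁ ≤ Algebra.adjoin k (insert (0 : K) ((R ⊔ A₁ : Subalgebra k K) : Set K)) :=
      fun x hx => Algebra.subset_adjoin (Set.mem_insert_of_mem _ hx)
    have hfr : IsFractionRing
        (Algebra.adjoin k (insert (0 : K) ((R ⊔ A₁ : Subalgebra k K) : Set K))) K :=
      isFractionRing_of_le (le_sup_right.trans hle) hA₁fr
    obtain ⟨A, hA, hle', -, hAfg, hAfr, hreg⟩ :=
      h k K O (R ⊔ A₁) hR'O 0 (hRfg.sup hA₁fg) h0 hfr
    exact ⟨A, hA, le_sup_left.trans hle', hAfg, hAfr, hreg⟩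
  · intro k K _ _ _ _ _ O A₀ h₀ t hfg htp hfrac
    -- verbatim the proof of `perfectTorsorLU_of_perfectLUrel` (which ignores regularity)
    classical
    obtain ⟨s₀, hs₀⟩ := hfg
    have hO : ∀ c : k, algebraMap k K c ∈ O := fun c => h₀ (A₀.algebraMap_mem c)
    have htO : t ∈ O := mem_of_pow_mem_valuationSubring O hp.ne_zero (h₀ htp)
    have hRs : Algebra.adjoin k (insert t (A₀ : Set K)) =
        Algebra.adjoin k (insert t (s₀ : Set K)) := by
      rw [← hs₀, Algebra.adjoin_insert_adjoin]
    have hRfg : (Algebra.adjoin k (insert t (A₀ : Set K))).FG :=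
      ⟨insert t s₀, by rw [Finset.coe_insert, hRs]⟩
    have hKfg : (⊤ : IntermediateField k K).FG := by
      refine ⟨insert t s₀, top_le_iff.mp fun z _ => ?_⟩
      obtain ⟨a, b, -, rfl⟩ :=
        IsFractionRing.div_surjective (A := Algebra.adjoin k (insert t (A₀ : Set K))) z
      have hle : Algebra.adjoin k (insert t (A₀ : Set K)) ≤
          (IntermediateField.adjoin k ((insert t s₀ : Finset K) : Set K)).toSubalgebra := by
        rw [hRs, Finset.coe_insert]
        exact IntermediateField.algebra_adjoin_le_adjoin k _
      exact div_mem (hle a.2) (hle b.2)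
    let Oalg : Subalgebra k K := { O.toSubring with algebraMap_mem' := hO }
    have hRO : (Algebra.adjoin k (insert t (A₀ : Set K))).toSubring ≤ O.toSubring := by
      change Algebra.adjoin k (insert t (A₀ : Set K)) ≤ Oalg
      exact Algebra.adjoin_le (Set.insert_subset htO fun x hx => h₀ hx)
    obtain ⟨A, h', hRA, hAfg, hAfr, hAreg⟩ := h k K hKfg O hO _ hRfg hRO
    exact ⟨A, h', fun x hx => hRA (Algebra.subset_adjoin (Set.mem_insert_of_mem t hx)),
      hRA (Algebra.subset_adjoin (Set.mem_insert t _)), hAfg, hAfr, hAreg⟩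

/-- (H2) The crux with the base's regularity dropped from its hypothesis is PROVABLE (it is
`C ↔ C`). [folklore] -/
theorem cruxNoRegH_holds : ∀ p : ℕ, p.Prime → PerfectTorsorLUNoReg p → PerfectLUrel p :=
  fun _ hp h => (perfectTorsorLUNoReg_iff hp).mp h

/-- Regularity at the centre of the smallest base `k[∅] = k ⊆ K` (its local ring is the field
`k`), for any valuation ring `O ⊇ k` — the base of every witness below. [folklore] -/
theorem isRegularLocalRing_centre_bot {k K : Type} [Field k] [Field K] [Algebra k K]
    (O : ValuationSubring K) (hO : ∀ c : k, algebraMap k K c ∈ O)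
    (h₀ : (Algebra.adjoin k (((∅ : Finset K) : Finset K) : Set K)).toSubring ≤ O.toSubring) :
    IsRegularLocalRing (Localization.AtPrime
      (Ideal.comap (Subring.inclusion h₀) (maximalIdeal O))) := by
  refine isRegularLocalRing_centre_adjoin_empty (S := k) (Ω := K) (algebraMap k K).injective O hO
    (fun s hs => ?_) h₀
  have : s = 0 := by
    have hbot : maximalIdeal k = ⊥ := (IsLocalRing.isField_iff_maximalIdeal_eq).mp (Field.toIsField k)
    simpa [hbot] using hs
  simp [this]

/-- `k[∅] ⊆ O` whenever `k ⊆ O`. [folklore] -/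
theorem adjoin_empty_le {k K : Type} [Field k] [Field K] [Algebra k K]
    (O : ValuationSubring K) (hO : ∀ c : k, algebraMap k K c ∈ O) :
    (Algebra.adjoin k (((∅ : Finset K) : Finset K) : Set K)).toSubring ≤ O.toSubring := by
  intro x hx
  have hx' : x ∈ Algebra.adjoin k (((∅ : Finset K) : Finset K) : Set K) := hx
  rw [Finset.coe_empty, Algebra.adjoin_empty, Algebra.mem_bot] at hx'
  obtain ⟨c, rfl⟩ := hx'
  exact hO c

/-- (H4) `H p` with the birationality hypothesis `Frac k[A₀, t] = K` dropped. -/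
def PerfectTorsorLUNoFrac (p : ℕ) : Prop :=
  ∀ (k K : Type) [Field k] [CharP k p] [PerfectField k] [Field K] [Algebra k K]
    (O : ValuationSubring K) (A₀ : Subalgebra k K) (h₀ : A₀.toSubring ≤ O.toSubring) (t : K),
    A₀.FG → t ^ p ∈ A₀ →
    IsRegularLocalRing (Localization.AtPrime
      (Ideal.comap (Subring.inclusion h₀) (maximalIdeal O))) →
    ∃ (A : Subalgebra k K) (h : A.toSubring ≤ O.toSubring), A₀ ≤ A ∧ t ∈ A ∧ A.FG ∧
      IsFractionRing A K ∧
      IsRegularLocalRing (Localization.AtPrime (Ideal.comap (Subring.inclusion h) (maximalIdeal O)))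

/-- (H4) **Without `Frac k[A₀, t] = K` the hypothesis is FALSE in every prime characteristic**
(`k = 𝔽_p`, `K = 𝔽_p^alg`, `O = K`, `A₀ = k`, `t = 0`: the base is regular at the centre, but no
finitely generated `A` has `Frac A = K`); so the crux with that hypothesis is vacuously true — a
trap. [folklore] -/
theorem not_perfectTorsorLUNoFrac {p : ℕ} (hp : p.Prime) : ¬ PerfectTorsorLUNoFrac p := by
  intro H
  haveI : Fact p.Prime := ⟨hp⟩
  set K := AlgebraicClosure (ZMod p)
  have hO : ∀ c : ZMod p, algebraMap (ZMod p) K c ∈ (⊤ : ValuationSubring K) :=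
    fun _ => ValuationSubring.mem_top _
  have h₀ := adjoin_empty_le (⊤ : ValuationSubring K) hO
  obtain ⟨A, -, -, -, hfg, hfr, -⟩ := H (ZMod p) K ⊤ _ h₀ 0 ⟨∅, rfl⟩
    (by rw [zero_pow hp.ne_zero]; exact Subalgebra.zero_mem _)
    (isRegularLocalRing_centre_bot ⊤ hO h₀)
  exact not_exists_fg_isFractionRing_algebraicClosure p ⟨A, hfg, hfr⟩

/-- (H5) `H p` with the radical condition `t ^ p ∈ A₀` dropped (nothing else added). -/
def PerfectTorsorLUNoTp (p : ℕ) : Prop :=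
  ∀ (k K : Type) [Field k] [CharP k p] [PerfectField k] [Field K] [Algebra k K]
    (O : ValuationSubring K) (A₀ : Subalgebra k K) (h₀ : A₀.toSubring ≤ O.toSubring) (t : K),
    A₀.FG → IsFractionRing (Algebra.adjoin k (insert t (A₀ : Set K))) K →
    IsRegularLocalRing (Localization.AtPrime
      (Ideal.comap (Subring.inclusion h₀) (maximalIdeal O))) →
    ∃ (A : Subalgebra k K) (h : A.toSubring ≤ O.toSubring), A₀ ≤ A ∧ t ∈ A ∧ A.FG ∧
      IsFractionRing A K ∧
      IsRegularLocalRing (Localization.AtPrime (Ideal.comap (Subring.inclusion h) (maximalIdeal O)))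

/-- (H5) **Dropping `t ^ p ∈ A₀` literally makes `H` FALSE for the silly reason `t ∉ O`**
(every prime: `k = 𝔽_p`, `K = 𝔽_p(X)`, `O` the place at infinity, `A₀ = k`, `t = X`): the
radical condition carries `t ∈ O`. The informative mutation is (H5′) below. [folklore] -/
theorem not_perfectTorsorLUNoTp {p : ℕ} (hp : p.Prime) : ¬ PerfectTorsorLUNoTp p := by
  intro H
  classical
  haveI : Fact p.Prime := ⟨hp⟩
  set K := RatFunc (ZMod p)
  set O : ValuationSubring K := (RatFunc.inftyValuation (ZMod p)).valuationSubring with hOdef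
  have hO : ∀ c : ZMod p, algebraMap (ZMod p) K c ∈ O := by
    intro c
    rw [hOdef, Valuation.mem_valuationSubring_iff]
    by_cases hc : c = 0
    · simp [hc]
    · rw [RatFunc.algebraMap_eq_C, RatFunc.inftyValuation.C _ hc]
  have h₀ := adjoin_empty_le O hO
  have hfrac : IsFractionRing
      (Algebra.adjoin (ZMod p) (insert (RatFunc.X : K)
        ((Algebra.adjoin (ZMod p) (((∅ : Finset K) : Finset K) : Set K) : Subalgebra (ZMod p) K) :
          Set K))) K := by
    refine IsFractionRing.of_field _ K fun z => ?_
    have hmem : ∀ f : Polynomial (ZMod p), algebraMap (Polynomial (ZMod p)) K f ∈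
        Algebra.adjoin (ZMod p) (insert (RatFunc.X : K)
          ((Algebra.adjoin (ZMod p) (((∅ : Finset K) : Finset K) : Set K) :
            Subalgebra (ZMod p) K) : Set K)) := by
      intro f
      rw [← RatFunc.aeval_X_left_eq_algebraMap]
      exact Algebra.adjoin_mono (Set.singleton_subset_iff.mpr (Set.mem_insert _ _))
        (Polynomial.aeval_mem_adjoin_singleton (ZMod p) _)
    refine ⟨⟨_, hmem z.num⟩, ⟨_, hmem z.denom⟩, ?_⟩
    change z = algebraMap (Polynomial (ZMod p)) K z.num / algebraMap (Polynomial (ZMod p)) K z.denom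
    rw [RatFunc.num_div_denom]
  obtain ⟨A, hA, -, hXA, -, -, -⟩ := H (ZMod p) K O _ h₀ RatFunc.X ⟨∅, rfl⟩ hfrac
    (isRegularLocalRing_centre_bot O hO h₀)
  have hX : (RatFunc.X : K) ∈ O := hA (A.mem_toSubring.mpr hXA)
  rw [hOdef, Valuation.mem_valuationSubring_iff, RatFunc.inftyValuation.X, ← WithZero.exp_zero,
    WithZero.exp_le_exp] at hX
  exact absurd hX (by decide)

/-! ### (P1) The binder `p.Prime` -/

/-- (P1) **`p.Prime` is NOT load-bearing**: the crux over ALL `p : ℕ` is equivalent to the crux.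
For composite `p ≠ 0` (and `p = 1`) no field has characteristic `p` (both sides vacuous); for
`p = 0` the hypothesis `H 0` is FALSE — `t ^ 0 = 1 ∈ A₀` holds for every `t`, including `t ∉ O`
(witness `t = X` at the place at infinity of `ℝ(X)`), so `H 0 → C 0` holds vacuously. [folklore] -/
theorem not_perfectTorsorLU_zero : ¬ PerfectTorsorLU 0 := by
  intro H
  classical
  set K := RatFunc ℝ
  set O : ValuationSubring K := (RatFunc.inftyValuation ℝ).valuationSubring with hOdef
  have hO : ∀ c : ℝ, algebraMap ℝ K c ∈ O := by
    intro c
    rw [hOdef, Valuation.mem_valuationSubring_iff]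
    by_cases hc : c = 0
    · simp [hc]
    · rw [RatFunc.algebraMap_eq_C, RatFunc.inftyValuation.C _ hc]
  have h₀ := adjoin_empty_le O hO
  have hfrac : IsFractionRing
      (Algebra.adjoin ℝ (insert (RatFunc.X : K)
        ((Algebra.adjoin ℝ (((∅ : Finset K) : Finset K) : Set K) : Subalgebra ℝ K) :
          Set K))) K := by
    refine IsFractionRing.of_field _ K fun z => ?_
    have hmem : ∀ f : Polynomial ℝ, algebraMap (Polynomial ℝ) K f ∈
        Algebra.adjoin ℝ (insert (RatFunc.X : K)
          ((Algebra.adjoin ℝ (((∅ : Finset K) : Finset K) : Set K) :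
            Subalgebra ℝ K) : Set K)) := by
      intro f
      rw [← RatFunc.aeval_X_left_eq_algebraMap]
      exact Algebra.adjoin_mono (Set.singleton_subset_iff.mpr (Set.mem_insert _ _))
        (Polynomial.aeval_mem_adjoin_singleton ℝ _)
    refine ⟨⟨_, hmem z.num⟩, ⟨_, hmem z.denom⟩, ?_⟩
    change z = algebraMap (Polynomial ℝ) K z.num / algebraMap (Polynomial ℝ) K z.denom
    rw [RatFunc.num_div_denom]
  obtain ⟨A, hA, -, hXA, -, -, -⟩ := H ℝ K O _ h₀ RatFunc.X ⟨∅, rfl⟩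
    (by rw [pow_zero]; exact Subalgebra.one_mem _) hfrac (isRegularLocalRing_centre_bot O hO h₀)
  have hX : (RatFunc.X : K) ∈ O := hA (A.mem_toSubring.mpr hXA)
  rw [hOdef, Valuation.mem_valuationSubring_iff, RatFunc.inftyValuation.X, ← WithZero.exp_zero,
    WithZero.exp_le_exp] at hX
  exact absurd hX (by decide)

/-- (P1) The crux over all `p : ℕ` is the crux. [folklore] -/
theorem cruxAllNat_iff :
    (∀ p : ℕ, PerfectTorsorLU p → PerfectLUrel p) ↔ Theses.FrobeniusClosing.TorsorToLurelPerfect := by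
  refine ⟨fun h p _ => h p, fun h p hH => ?_⟩
  by_cases hp : p.Prime
  · exact h p hp hH
  · rcases Nat.eq_zero_or_pos p with rfl | hpos
    · exact absurd hH not_perfectTorsorLU_zero
    · intro k K _ _ _ _ _ _ O _ R _ _
      exfalso
      rcases CharP.char_is_prime_or_zero k p with h' | h'
      · exact hp h'
      · omega

/-! ### (H5′) The informative mutation: arbitrary simple extensions inside `O`

`PerfectSimpleLU p` is `H p` with the radical condition `t ^ p ∈ A₀` REPLACED by `t ∈ O`. It is
EQUIVALENT to `C p` by a generator induction through intermediate fields (the tree's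
`torsor_step` pattern with the `p`-th power condition deleted), so the crux with this hypothesis
is a triviality: ALL content of `TorsorToLurelPerfect` is the restriction of its hypothesis to
RADICAL simple extensions — exactly what Temkin's inseparable local uniformization (Thm. 1.3.2)
plus Frobenius transport over a perfect field pays for. -/

/-- (H5′) `H p` with `t ^ p ∈ A₀` replaced by `t ∈ O`: LU of ARBITRARY simple extensions
`k[A₀, t] ⊆ O` of bases regular at the centre, over perfect ground fields. -/
def PerfectSimpleLU (p : ℕ) : Prop :=
  ∀ (k K : Type) [Field k] [CharP k p] [PerfectField k] [Field K] [Algebra k K]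
    (O : ValuationSubring K) (A₀ : Subalgebra k K) (h₀ : A₀.toSubring ≤ O.toSubring) (t : K),
    A₀.FG → t ∈ O → IsFractionRing (Algebra.adjoin k (insert t (A₀ : Set K))) K →
    IsRegularLocalRing (Localization.AtPrime
      (Ideal.comap (Subring.inclusion h₀) (maximalIdeal O))) →
    ∃ (A : Subalgebra k K) (h : A.toSubring ≤ O.toSubring), A₀ ≤ A ∧ t ∈ A ∧ A.FG ∧
      IsFractionRing A K ∧
      IsRegularLocalRing (Localization.AtPrime (Ideal.comap (Subring.inclusion h) (maximalIdeal O)))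

/-- A chart through `k[A₀, t]` from `C p`, for ANY finitely generated `A₀ ⊆ O` and `t ∈ O` with
`Frac k[A₀, t] = K` (the common core of `C → H`, `C → H_noReg`, `C → SimpleLU`). [folklore] -/
theorem simpleChart_of_perfectLUrel {p : ℕ} (hC : PerfectLUrel p) {k K : Type} [Field k]
    [CharP k p] [PerfectField k] [Field K] [Algebra k K] (O : ValuationSubring K)
    (A₀ : Subalgebra k K) (h₀ : A₀.toSubring ≤ O.toSubring) (t : K) (hfg : A₀.FG) (htO : t ∈ O)
    (hfrac : IsFractionRing (Algebra.adjoin k (insert t (A₀ : Set K))) K) :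
    ∃ (A : Subalgebra k K) (h : A.toSubring ≤ O.toSubring), A₀ ≤ A ∧ t ∈ A ∧ A.FG ∧
      IsFractionRing A K ∧
      IsRegularLocalRing (Localization.AtPrime (Ideal.comap (Subring.inclusion h) (maximalIdeal O))) := by
  classical
  obtain ⟨s₀, hs₀⟩ := hfg
  have hO : ∀ c : k, algebraMap k K c ∈ O := fun c => h₀ (A₀.algebraMap_mem c)
  have hRs : Algebra.adjoin k (insert t (A₀ : Set K)) = Algebra.adjoin k (insert t (s₀ : Set K)) := by
    rw [← hs₀, Algebra.adjoin_insert_adjoin]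
  have hRfg : (Algebra.adjoin k (insert t (A₀ : Set K))).FG :=
    ⟨insert t s₀, by rw [Finset.coe_insert, hRs]⟩
  have hKfg : (⊤ : IntermediateField k K).FG := by
    refine ⟨insert t s₀, top_le_iff.mp fun z _ => ?_⟩
    obtain ⟨a, b, -, rfl⟩ :=
      IsFractionRing.div_surjective (A := Algebra.adjoin k (insert t (A₀ : Set K))) z
    have hle : Algebra.adjoin k (insert t (A₀ : Set K)) ≤
        (IntermediateField.adjoin k ((insert t s₀ : Finset K) : Set K)).toSubalgebra := by
      rw [hRs, Finset.coe_insert]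
      exact IntermediateField.algebra_adjoin_le_adjoin k _
    exact div_mem (hle a.2) (hle b.2)
  let Oalg : Subalgebra k K := { O.toSubring with algebraMap_mem' := hO }
  have hRO : (Algebra.adjoin k (insert t (A₀ : Set K))).toSubring ≤ O.toSubring := by
    change Algebra.adjoin k (insert t (A₀ : Set K)) ≤ Oalg
    exact Algebra.adjoin_le (Set.insert_subset htO fun x hx => h₀ hx)
  obtain ⟨A, h, hRA, hAfg, hAfr, hAreg⟩ := hC k K hKfg O hO _ hRfg hRO
  exact ⟨A, h, fun x hx => hRA (Algebra.subset_adjoin (Set.mem_insert_of_mem t hx)),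
    hRA (Algebra.subset_adjoin (Set.mem_insert t _)), hAfg, hAfr, hAreg⟩

/-- (H5′) `C p → SimpleLU p`. [folklore] -/
theorem perfectSimpleLU_of_perfectLUrel {p : ℕ} (hC : PerfectLUrel p) : PerfectSimpleLU p :=
  fun _ _ _ _ _ _ _ O A₀ h₀ t hfg htO hfrac _ => simpleChart_of_perfectLUrel hC O A₀ h₀ t hfg htO hfrac

section simpleClimb

variable {p : ℕ} (hS : PerfectSimpleLU p)
  {k K : Type} [Field k] [CharP k p] [PerfectField k] [Field K] [Algebra k K]
  (O : ValuationSubring K)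

include hS

/-- (H5′) **One simple step inside `K`** (the tree's `torsor_step` with `t ^ p ∈ A₀` replaced by
`t ∈ O`): if `A₀ ⊆ O` is a finitely generated `k`-subalgebra regular at the centre and `t ∈ O`,
then — `SimpleLU` applied to the subfield `E = k(A₀, t)` made a type, the valuation ring `O ∩ E`
and the copy of `A₀` in `E` — there is a finitely generated `A ⊇ A₀ ∪ {t}` inside `O`, regular
at the centre. [folklore] -/
theorem simple_step (A₀ : Subalgebra k K) (h₀ : A₀.toSubring ≤ O.toSubring) (hfg : A₀.FG)
    (hreg : IsRegularLocalRing (Localization.AtPrime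
      (Ideal.comap (Subring.inclusion h₀) (maximalIdeal O))))
    (t : K) (htO : t ∈ O) :
    ∃ (A : Subalgebra k K) (h : A.toSubring ≤ O.toSubring), A₀ ≤ A ∧ t ∈ A ∧ A.FG ∧
      IsRegularLocalRing (Localization.AtPrime
        (Ideal.comap (Subring.inclusion h) (maximalIdeal O))) := by
  classical
  set E : IntermediateField k K := IntermediateField.adjoin k (insert t (A₀ : Set K)) with hE
  let ι : E →+* K := (E.val : E →ₐ[k] K)
  let O' : ValuationSubring E := O.comap ι
  let A₀' : Subalgebra k E := A₀.comap E.val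
  have htE : t ∈ E := IntermediateField.subset_adjoin k _ (Set.mem_insert t _)
  have hA₀E : A₀ ≤ E.val.range := by
    intro x hx
    exact ⟨⟨x, IntermediateField.subset_adjoin k _ (Set.mem_insert_of_mem t hx)⟩, rfl⟩
  have hmap : A₀'.map E.val = A₀ := Subalgebra.map_comap_eq_self hA₀E
  let t' : E := ⟨t, htE⟩
  have h₀' : A₀'.toSubring ≤ O'.toSubring := by
    intro x hx
    change ι x ∈ O
    exact h₀ (show (x : K) ∈ A₀ from hx)
  have hfg' : A₀'.FG :=
    Subalgebra.fg_of_fg_map _ E.val (fun _ _ h => Subtype.ext h) (by rw [hmap]; exact hfg)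
  have htO' : t' ∈ O' := by
    change ι t' ∈ O
    exact htO
  have hadj : (Algebra.adjoin k (insert t' (A₀' : Set E))).map E.val =
      Algebra.adjoin k (insert t (A₀ : Set K)) := by
    have himg : (E.val : E → K) '' (A₀' : Set E) = (A₀ : Set K) := by
      rw [← Subalgebra.coe_map, hmap]
    rw [AlgHom.map_adjoin, Set.image_insert_eq, himg]
    rfl
  have hfrac' : IsFractionRing (Algebra.adjoin k (insert t' (A₀' : Set E))) E := by
    refine IsFractionRing.of_field _ E fun z => ?_
    have hz : (z : K) ∈ IntermediateField.adjoin k (insert t (A₀ : Set K)) := z.2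
    obtain ⟨r, hr, s, hs, hrs⟩ := IntermediateField.mem_adjoin_iff_div.mp hz
    rw [← hadj] at hr hs
    obtain ⟨r', hr', rfl⟩ := Subalgebra.mem_map.mp hr
    obtain ⟨s', hs', rfl⟩ := Subalgebra.mem_map.mp hs
    refine ⟨⟨r', hr'⟩, ⟨s', hs'⟩, Subtype.ext ?_⟩
    simpa using hrs
  have hreg' : IsRegularLocalRing (Localization.AtPrime
      (Ideal.comap (Subring.inclusion h₀') (maximalIdeal O'))) := by
    have hB : A₀'.toSubring.map ι = A₀.toSubring := by
      ext x
      constructor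
      · rintro ⟨y, hy, rfl⟩
        exact hy
      · intro hx
        obtain ⟨y, rfl⟩ := hA₀E hx
        exact ⟨y, hx, rfl⟩
    exact (Theorems.isRegularLocalRing_centre_map_iff ι O A₀'.toSubring A₀.toSubring hB h₀' h₀).mpr
      hreg
  -- apply `SimpleLU` inside `E` (ground field still the perfect `k`)
  obtain ⟨A', h', hle', ht', hfgA', -, hregA'⟩ := hS k E O' A₀' h₀' t' hfg' htO' hfrac' hreg'
  -- push the chart forward to `K`
  let A : Subalgebra k K := A'.map E.val
  have h : A.toSubring ≤ O.toSubring := by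
    rintro _ ⟨y, hy, rfl⟩
    exact h' hy
  refine ⟨A, h, ?_, ⟨t', ht', rfl⟩, hfgA'.map _, ?_⟩
  · rw [← hmap]
    exact Subalgebra.map_mono hle'
  · have hB : A'.toSubring.map ι = A.toSubring := by
      ext x
      constructor
      · rintro ⟨y, hy, rfl⟩
        exact ⟨y, hy, rfl⟩
      · rintro ⟨y, hy, rfl⟩
        exact ⟨y, hy, rfl⟩
    exact (Theorems.isRegularLocalRing_centre_map_iff ι O A'.toSubring A.toSubring hB h' h).mp hregA'

/-- (H5′) **Finitely many simple steps.** [folklore] -/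
theorem simple_steps (G : Finset K) :
    ∀ (A₀ : Subalgebra k K) (h₀ : A₀.toSubring ≤ O.toSubring), A₀.FG →
      IsRegularLocalRing (Localization.AtPrime
        (Ideal.comap (Subring.inclusion h₀) (maximalIdeal O))) →
      (∀ g ∈ G, g ∈ O) →
      ∃ (A : Subalgebra k K) (h : A.toSubring ≤ O.toSubring), A₀ ≤ A ∧ (∀ g ∈ G, g ∈ A) ∧ A.FG ∧
        IsRegularLocalRing (Localization.AtPrime
          (Ideal.comap (Subring.inclusion h) (maximalIdeal O))) := by
  classical
  induction G using Finset.induction_on with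
  | empty =>
    intro A₀ h₀ hfg hreg _
    exact ⟨A₀, h₀, le_rfl, fun g hg => absurd hg (Finset.notMem_empty g), hfg, hreg⟩
  | insert g G hgG ih =>
    intro A₀ h₀ hfg hreg hGO
    obtain ⟨A₁, h₁, hle₁, hG₁, hfg₁, hreg₁⟩ := ih A₀ h₀ hfg hreg
      (fun x hx => hGO x (Finset.mem_insert_of_mem hx))
    obtain ⟨A, h, hle, hgA, hfgA, hregA⟩ :=
      simple_step hS O A₁ h₁ hfg₁ hreg₁ g (hGO g (Finset.mem_insert_self g G))
    refine ⟨A, h, hle₁.trans hle, fun x hx => ?_, hfgA, hregA⟩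
    rcases Finset.mem_insert.mp hx with rfl | hx
    · exact hgA
    · exact hle (hG₁ x hx)

/-- (H5′) **`SimpleLU p → C p`**: climb from the base `k[∅] = k` (regular at the centre) through
the generators of `R` and of an affine model of `K` inside `O`. No Temkin, no Frobenius, no
radical tower. [folklore] -/
theorem perfectLUrel_of_perfectSimpleLU : PerfectLUrel p := by
  intro k K _ _ _ _ _ hKfg O hO R hRfg hRO
  classical
  obtain ⟨A₁, hA₁O, hA₁fg, hA₁fr⟩ := exists_affineModel k K hKfg O hO
  obtain ⟨sR, hsR⟩ := hRfg
  obtain ⟨s₁, hs₁⟩ := hA₁fg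
  have h₀ := adjoin_empty_le O hO
  have hGO : ∀ g ∈ sR ∪ s₁, g ∈ O := by
    intro g hg
    rcases Finset.mem_union.mp hg with hg | hg
    · exact hRO (hsR ▸ Algebra.subset_adjoin hg : g ∈ R)
    · exact hA₁O (hs₁ ▸ Algebra.subset_adjoin hg : g ∈ A₁)
  obtain ⟨A, h, -, hG, hAfg, hreg⟩ := simple_steps hS O (sR ∪ s₁) _ h₀ ⟨∅, rfl⟩
    (isRegularLocalRing_centre_bot O hO h₀) hGO
  have hRA : R ≤ A := by
    rw [← hsR]
    exact Algebra.adjoin_le fun g hg => hG g (Finset.mem_union_left _ hg)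
  have hA₁A : A₁ ≤ A := by
    rw [← hs₁]
    exact Algebra.adjoin_le fun g hg => hG g (Finset.mem_union_right _ hg)
  exact ⟨A, h, hRA, hAfg, isFractionRing_of_le hA₁A hA₁fr, hreg⟩

end simpleClimb

/-- (H5′) **`SimpleLU p ↔ C p`.** [folklore] -/
theorem perfectSimpleLU_iff_perfectLUrel (p : ℕ) : PerfectSimpleLU p ↔ PerfectLUrel p :=
  ⟨fun hS => perfectLUrel_of_perfectSimpleLU hS, perfectSimpleLU_of_perfectLUrel⟩

/-- (H5′) … so **the crux with its hypothesis widened from radical to arbitrary simple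
extensions inside `O` is a TRIVIALITY** (provable outright, every `p`): all content of
`TorsorToLurelPerfect` is the restriction `t ^ p ∈ A₀`. [folklore] -/
theorem cruxSimple_holds : ∀ p : ℕ, p.Prime → PerfectSimpleLU p → PerfectLUrel p :=
  fun _ _ hS => perfectLUrel_of_perfectSimpleLU hS

/-- (H5′) `SimpleLU p → H p` (radical simple extensions are simple extensions inside `O`).
[folklore] -/
theorem perfectTorsorLU_of_perfectSimpleLU {p : ℕ} (hp : p.Prime) (hS : PerfectSimpleLU p) :
    PerfectTorsorLU p :=
  fun k K _ _ _ _ _ O A₀ h₀ t hfg htp hfrac hreg =>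
    hS k K O A₀ h₀ t hfg (mem_of_pow_mem_valuationSubring O hp.ne_zero (h₀ htp)) hfrac hreg

/-! ## §4 Targets — pre-analysis of the registered line `temkin-leaf` (stubs not yet handed to this seat)

The skeleton `Lines/temkin_leaf.lean` (strategist, 2026-08-17) cuts the crux into
`stub_smoothFibreLeaf` (= the Literature named fact `Temkin2013RelativeCurveSmoothFibre.{0}`,
Temkin 2013 Thm. 3.3.1 for `k`-smooth generic fibres), `stub_perfectChartOfTemkin`
(`Temkin2013Relative.{0} →` Frobenius-pushed chart) and `stub_perfectTowerClimb` (pushed chart ⇒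
honest chart, with `H p`). The line file cannot be imported here (it carries `sorry`), so its
`PushedChart` is restated verbatim. Findings: stubs 2 and 3 are SUMMIT-IMPLIED (below), hence as
irrefutable as the crux; the ONLY node of the line that is not a consequence of
`ResolutionInChar p` is the leaf — a statement about relative curves over valued fields of height
one with a smooth-equivalence conclusion (`Temkin2013RelativeCurveConclusion`), whose only
conceivable failure is a MIS-RENDERING of the printed theorem (audit target for a Literature /
barrier-audit seat; this seat did not audit it). -/

/-- The Frobenius-pushed chart of line `temkin-leaf` / `birth` (verbatim `Lines.TemkinLeaf.PushedChart`). -/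
def PushedChart (p : ℕ) (k K : Type) [Field k] [Field K] [Algebra k K] (O : ValuationSubring K)
    (R : Subalgebra k K) : Prop :=
  ∃ (m : ℕ) (A₀ : Subalgebra k K) (h₀ : A₀.toSubring ≤ O.toSubring), A₀.FG ∧
    (∀ r ∈ R, r ^ p ^ m ∈ A₀) ∧
    (∀ x : K, x ^ p ^ m ∈ IntermediateField.adjoin k (A₀ : Set K)) ∧
    IsRegularLocalRing (Localization.AtPrime
      (Ideal.comap (Subring.inclusion h₀) (maximalIdeal O)))

/-- `C p` gives the pushed chart with `m = 0` (verbatim the line's `pushedChart_of_perfectLUrel`).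
[folklore] -/
theorem pushedChart_of_perfectLUrel {p : ℕ} (h : PerfectLUrel p)
    (k K : Type) [Field k] [CharP k p] [PerfectField k] [Field K] [Algebra k K]
    (hfg : (⊤ : IntermediateField k K).FG) (O : ValuationSubring K)
    (hO : ∀ c : k, algebraMap k K c ∈ O) (R : Subalgebra k K) (hRfg : R.FG)
    (hRO : R.toSubring ≤ O.toSubring) : PushedChart p k K O R := by
  obtain ⟨A, h, hRA, hAfg, hAfr, hreg⟩ := h k K hfg O hO R hRfg hRO
  refine ⟨0, A, h, hAfg, fun r hr => ?_, fun x => ?_, hreg⟩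
  · simpa using hRA hr
  · haveI := hAfr
    obtain ⟨a, b, -, rfl⟩ := IsFractionRing.div_surjective (A := A) x
    simp only [pow_zero, pow_one]
    exact div_mem (IntermediateField.subset_adjoin k _ a.2) (IntermediateField.subset_adjoin k _ b.2)

/-- The conclusion of `stub_perfectChartOfTemkin` (= split child `PerfectFrobeniusChart`). -/
def PerfectFrobeniusChart : Prop :=
  ∀ p : ℕ, p.Prime → ∀ (k K : Type) [Field k] [CharP k p] [PerfectField k] [Field K] [Algebra k K],
    (⊤ : IntermediateField k K).FG → ∀ O : ValuationSubring K, (∀ c : k, algebraMap k K c ∈ O) →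
    ∀ R : Subalgebra k K, R.FG → R.toSubring ≤ O.toSubring → PushedChart p k K O R

/-- **Stub 2's conclusion is summit-implied** (`Res p → C p → PushedChart`, `m = 0`): no
refutation of `PerfectFrobeniusChart` short of `¬ResolutionInChar p`; as a stub
(`Temkin2013Relative.{0} → PerfectFrobeniusChart`) it is moreover Temkin's theorem read over a
perfect field. [folklore] -/
theorem perfectFrobeniusChart_of_summit (hS : _root_.ResolutionOfSingularities) :
    PerfectFrobeniusChart :=
  fun p hp k K _ _ _ _ _ hfg O hO R hRfg hRO =>
    pushedChart_of_perfectLUrel (perfectLUrel_of_resolutionInChar hp (hS p hp)) k K hfg O hO R hRfg hRO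

/-- The statement of `stub_perfectTowerClimb` (= split child `PerfectTowerClimb`), verbatim. -/
def PerfectTowerClimb : Prop :=
  ∀ p : ℕ, p.Prime → PerfectTorsorLU p →
    ∀ (k K : Type) [Field k] [CharP k p] [PerfectField k] [Field K] [Algebra k K],
      (⊤ : IntermediateField k K).FG → ∀ O : ValuationSubring K, (∀ c : k, algebraMap k K c ∈ O) →
      ∀ R : Subalgebra k K, R.FG → R.toSubring ≤ O.toSubring → PushedChart p k K O R →
      ∃ (A : Subalgebra k K) (h : A.toSubring ≤ O.toSubring), R ≤ A ∧ A.FG ∧ IsFractionRing A K ∧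
        IsRegularLocalRing (Localization.AtPrime
          (Ideal.comap (Subring.inclusion h) (maximalIdeal O)))

/-- **Stub 3 is WEAKER than the crux** (it has the extra hypothesis `PushedChart`), hence
summit-implied: no refutation short of `¬ResolutionInChar p`. [folklore] -/
theorem perfectTowerClimb_of_crux (h : Theses.FrobeniusClosing.TorsorToLurelPerfect) :
    PerfectTowerClimb :=
  fun p hp hH k K _ _ _ _ _ hfg O hO R hRfg hRO _ => h p hp hH k K hfg O hO R hRfg hRO

theorem perfectTowerClimb_of_summit (hS : _root_.ResolutionOfSingularities) : PerfectTowerClimb :=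
  perfectTowerClimb_of_crux (crux_of_summit hS)

/-- The split glue, for the record: `PerfectFrobeniusChart → PerfectTowerClimb → crux` (so the
two summit-implied children are jointly SUFFICIENT; nothing is smuggled). [folklore] -/
theorem crux_of_children (h₁ : PerfectFrobeniusChart) (h₂ : PerfectTowerClimb) :
    Theses.FrobeniusClosing.TorsorToLurelPerfect :=
  fun p hp hT k K _ _ _ _ _ hfg O hO R hRfg hRO =>
    h₂ p hp hT k K hfg O hO R hRfg hRO (h₁ p hp k K hfg O hO R hRfg hRO)

/-! ## §5 Regimes tried, why nothing bites, what WOULD kill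

* Junk valuation `O = K`, valuation rings essentially of finite type, divisorial `O`: `C` is FREE
  there (`perfectLUrel_at_top`, tree `lurel_of_essFiniteType`), and `H` inherits the freeness
  through `C → H`.
* Degenerate dimensions: `trdeg K/k = 0` ⇒ `O = K` (free); `trdeg ≤ 3` ⇒ `C` is Cossart–Piltant
  (not in tree as a theorem, `CossartPiltant2019` is a named fact) — no small model separates `H`
  from `C`.
* Abhyankar places: free over perfect `k` (Knaf–Kuhlmann, tree); the hard core of both `H` and `C`
  is Kuhlmann's defect / rank-deficient zero-dimensional valuations (`perfectLUrelHard_iff`), in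
  `trdeg ≥ 4` — i.e. the open part of the summit itself.
* Hypothesis mutations: every deletion either makes the statement summit-implied-and-stronger
  (irrefutable here) or false-for-junk (trap) or trivial; the kernel-checked table is §2–§3.
* Barrier catalogue (`Literature/Barriers/ResolutionOfSingularities/`): `InseparableBaseChange` /
  `RegularNotGeometricallyRegular` do not touch the crux — the ground field is the same perfect
  `k` on both sides and Frobenius transport is a ring isomorphism; `LocalMonomializationFails*`,
  `ArtinSchreierPuiseux`, `KangarooShadeIncrease`, `NarasimhanMaximalContact` live INSIDE `H`
  (they obstruct proofs of torsor LU, i.e. produce `¬H` candidates, never `H ∧ ¬C`);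
  `DimensionFourFrontier` applies to `H` and `C` alike (both open exactly in `trdeg ≥ 4`). Ledger
  negatives (2026-08-17): one entry (DefectlessFrames 19085, hypersurface frames) — unrelated.
* Not formalized (folklore tightness, low value): the modification `A ⊋ k[A₀, t]` in `H`'s
  conclusion is necessary — the torsor itself can be singular at the centre over a regular base
  (cusp `k[s², s³] = k[u][t]/(t² − u³)`, `p = 2`, `A₀ = k[u]`, `s`-adic place).
* WHAT WOULD KILL: only (a) a counterexample to local uniformization over a perfect field in
  characteristic `p` (= `¬C p`, hence `¬ResolutionInChar p`), or (b) nothing else — by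
  `crux_iff_forall_iff` there is no failure mode of the crux independent of (a). For the LINE
  (not the crux): a mis-rendering of Temkin 2013 Thm. 3.3.1 in the Literature leaf
  `Temkin2013RelativeCurveSmoothFibre` would sink `temkin-leaf`'s stub 1 without touching the crux.
-/

end

end Summit.ResolutionOfSingularities.ResolutionOfSingularities.Cruxes.TorsorToLurelPerfect.Disproof
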